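/-
Copyright (c) 2026. Released under the Apache 2.0 license.
-/
import Mathlib
import Literature.NumberTheory.EllipticCurves.CongruenceNumber
import Literature.NumberTheory.EllipticCurves.CuspFormsGamma0IntegralBasisProofs
import Literature.NumberTheory.EllipticCurves.IntegralCuspForms
import HarnessLib

/-!
# `S_k(Γ₀(N); A) = S_k(Γ₀(N); ℤ) ⊗ A` for a subring `A ⊆ ℂ`: cusp forms with coefficients in `A`
# are `A`-linear combinations of integral cusp forms (Agashe–Ribet–Stein 2006, Lemma 3.2 — proved)

A. Agashe, K. Ribet, W. A. Stein, *The Manin constant*, PAMQ 2 (2006) 617–636, §3.1 (p. 620):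
"If `R` is a subring of `ℂ`, let `S₂(R) = S₂(Γ; R)` denote the `𝕋`-submodule of `S₂(Γ; ℂ)` of
modular forms whose Fourier expansions have all coefficients in `R`. … **Lemma 3.2.** We have
`S₂(R) ≅ S₂(ℤ) ⊗ R`." (proof there: [DI95, Thm. 12.3.2] for the algebraic analogues, identified
with these spaces by the `q`-expansion maps [DI95, Thm. 12.3.7]).

THIS FILE PROVES, for `Γ = Γ₀(N)` (`N ≥ 1`) and every weight `k ≥ 2`, the content of the lemma in
the concrete form the tree states it (no tensor product): **every cusp form on `Γ₀(N)` all of whose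
Fourier coefficients at `∞` lie in a subring `A ⊆ ℂ` is an `A`-linear combination of cusp forms
with integer coefficients** — `mem_span_integralCuspForms0_of_forall_cuspCoeff_mem`; equivalently
the natural map `S_k(Γ₀(N); ℤ) ⊗_ℤ A → S_k(Γ₀(N))` has image exactly the forms with coefficients
in `A` (the reverse inclusion is trivial). Theorems only: no definition, no named fact, no axiom.
(Companion of `IntegralCuspForms.lean`, request `defn-IntegralCuspFormsQExpansionPrinciple` of the
route TameQuarticManinParity of the BSD summit: the main theorem is stated over the tree's
`integralCuspForms0` and `cuspCoeff` directly, and restated for that file's `A`-submodule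
`integralCuspFormsIn N k A = S_k(Γ₀(N); A)` as the equality
`integralCuspFormsIn_eq_span_integralCuspForms0`.)

## The proof (elementary lattice theory; not the route of ARS/DI95, which goes through the
## algebraic theory of modular forms)

Abstractly (`mem_span_of_forall_dual_mem`, [folklore]): let `V` be a finite-dimensional vector space
over a field `K` of characteristic `0`, `(aᵢ)` a family of linear functionals separating the points
of `V`, `L = {v | aᵢ(v) ∈ ℤ for all i}` and suppose `L` spans `V` over `K`. Then for every subring
`A ⊆ K`, `{v | aᵢ(v) ∈ A for all i} ⊆ span_A L`. Steps:
1. (`span_range_dual_eq_top`) the `aᵢ` span the dual space `V^*` (double annihilator); picking a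
   basis of `V^*` among them, `v ↦ (aᵢ(v))` restricted to that basis embeds `L` into `ℤ^d`
   (`d = dim V`), so `L` is free of rank `≤ d`; a `K`-basis of `V` inside `L` gives rank `≥ d`;
   hence (`exists_int_basis`) `L` has a `ℤ`-basis `w₁, …, w_d` which is a `K`-basis of `V`, and
   `L` is exactly the set of vectors with integer `w`-coordinates.
2. (`span_int_eq_top_of_forall_rat_pairing`) SATURATION: the integer row vectors
   `αᵢ = (aᵢ(w₁), …, aᵢ(w_d)) ∈ ℤ^d` span `ℤ^d` over `ℤ`. Indeed, if their span `M` were proper, a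
   non-trivial character `χ : ℤ^d/M → ℚ/ℤ` (Mathlib `CharacterModule`) lifts to a rational vector
   `y ∉ ℤ^d` with `αᵢ · y ∈ ℤ` for all `i`; but then `v = ∑ yⱼ wⱼ` has all `aᵢ(v) ∈ ℤ`, so `v ∈ L`,
   so `y ∈ ℤ^d` — contradiction.
3. Hence each coordinate functional `wⱼ^*` is an INTEGER combination `∑ᵢ cᵢ aᵢ` (finitely many
   `i`), so a vector with all `aᵢ(v) ∈ A` has all coordinates `wⱼ^*(v) = ∑ cᵢ aᵢ(v) ∈ A`, i.e.
   `v = ∑ wⱼ^*(v) wⱼ ∈ span_A L`.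
For `V = S_k(Γ₀(N))`, `aₙ = ` the `n`-th Fourier coefficient (`cuspCoeffₗ`; separating by the
`q`-expansion principle `eq_of_forall_cuspCoeff_eq_gamma0`), `L = integralCuspForms0 N k`, and the
spanning hypothesis is Shimura's integral basis (Thm. 3.52; tree `span_setOf_int_cuspCoeff_eq_top`,
`k ≥ 2`).

## References

* [AgasheRibetStein2006] A. Agashe, K. Ribet, W. A. Stein, *The Manin constant*, Pure Appl. Math.
  Q. 2 (2006), no. 2, 617–636 — §3.1 (p. 620), Lemma 3.2 (held text
  `paper:doi-10-4310-pamq-2006-v2-n2-a11`, p. 4).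
* [DiamondIm1995] F. Diamond, J. Im, *Modular forms and modular curves* (1995), Thm. 12.3.2,
  Thm. 12.3.7 (the printed route, cited through ARS).
* [Shimura1971] G. Shimura, *Introduction to the arithmetic theory of automorphic functions*,
  Thm. 3.52 (integral basis).
-/

noncomputable section

open scoped MatrixGroups ModularForm

open CongruenceSubgroup UpperHalfPlane Module Submodule

namespace Literature.NumberTheory.EllipticCurves.ModularForms

/-! ### Lattice lemmas -/

section Lattice

/-- **Saturation test by rational vectors.** A subgroup `M = span_ℤ S` of `ℤ^d` such that every
RATIONAL vector `y` pairing integrally with all of `S` (`∑ⱼ mⱼ yⱼ ∈ ℤ` for `m ∈ S`) is itself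
integral, is all of `ℤ^d`. (If `M ≠ ℤ^d`, a non-zero character `ℤ^d/M → ℚ/ℤ` — Mathlib's
`CharacterModule` has enough of them — lifts to such a `y ∉ ℤ^d`.) Private helper of
`mem_span_integralCuspForms0_of_forall_cuspCoeff_mem`. [folklore] -/
private theorem span_int_eq_top_of_forall_rat_pairing {d : ℕ} {S : Set (Fin d → ℤ)}
    (h : ∀ y : Fin d → ℚ, (∀ m ∈ S, ∃ z : ℤ, (z : ℚ) = ∑ j, (m j : ℚ) * y j) →
      ∀ j, ∃ z : ℤ, (z : ℚ) = y j) :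
    Submodule.span ℤ S = ⊤ := by
  set M := Submodule.span ℤ S with hM
  by_contra hne
  obtain ⟨q, hq⟩ : ∃ q : (Fin d → ℤ) ⧸ M, q ≠ 0 := by
    by_contra! hall
    apply hne
    refine eq_top_iff.mpr fun x _ ↦ ?_
    exact (Submodule.Quotient.mk_eq_zero M).mp (hall _)
  obtain ⟨χ, hχ⟩ := CharacterModule.exists_character_apply_ne_zero_of_ne_zero hq
  -- the projection `ℚ → ℚ/ℤ` as an additive homomorphism
  set π : ℚ →+ AddCircle (1 : ℚ) := QuotientAddGroup.mk' (AddSubgroup.zmultiples (1 : ℚ)) with hπ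
  have hπapply : ∀ x : ℚ, π x = (x : AddCircle (1 : ℚ)) := fun x ↦ rfl
  have hlift : ∀ j, ∃ y : ℚ, π y = χ (Submodule.Quotient.mk (Pi.single j (1 : ℤ))) :=
    fun j ↦ QuotientAddGroup.mk_surjective _
  choose y hy using hlift
  -- the character, pulled back to `ℤ^d`, is `m ↦ ∑ mⱼ yⱼ mod ℤ`
  have hχm : ∀ m : Fin d → ℤ,
      χ (Submodule.Quotient.mk m) = π (∑ j, (m j : ℚ) * y j) := by
    intro m
    have hdecomp : m = ∑ j, m j • (Pi.single j (1 : ℤ) : Fin d → ℤ) := by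
      ext l
      simp [Finset.sum_apply, Pi.single_apply]
    conv_lhs => rw [hdecomp]
    rw [← Submodule.mkQ_apply, map_sum, map_sum, map_sum]
    refine Finset.sum_congr rfl fun j _ ↦ ?_
    rw [map_zsmul, map_zsmul, Submodule.mkQ_apply, ← hy j, ← zsmul_eq_mul, map_zsmul]
  have hint : ∀ m ∈ S, ∃ z : ℤ, (z : ℚ) = ∑ j, (m j : ℚ) * y j := by
    intro m hm
    have hm0 : (Submodule.Quotient.mk m : (Fin d → ℤ) ⧸ M) = 0 :=
      (Submodule.Quotient.mk_eq_zero M).mpr (Submodule.subset_span hm)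
    have h0 : ((∑ j, (m j : ℚ) * y j : ℚ) : AddCircle (1 : ℚ)) = 0 := by
      rw [← hπapply, ← hχm m, hm0, map_zero]
    obtain ⟨n, hn⟩ := (AddCircle.coe_eq_zero_iff (1 : ℚ)).mp h0
    exact ⟨n, by simpa using hn⟩
  have hyint := h y hint
  apply hχ
  have hzero : ∀ j, χ (Submodule.Quotient.mk (Pi.single j (1 : ℤ))) = 0 := by
    intro j
    obtain ⟨z, hz⟩ := hyint j
    rw [← hy j, ← hz, hπapply]
    exact (AddCircle.coe_eq_zero_iff (1 : ℚ)).mpr ⟨z, by simp⟩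
  have hcomp : χ.comp M.mkQ.toAddMonoidHom = 0 := by
    refine AddMonoidHom.functions_ext _ _ _ fun j x ↦ ?_
    have hx : (Pi.single j x : Fin d → ℤ) = x • Pi.single j (1 : ℤ) := by
      ext l
      simp [Pi.single_apply]
    rw [AddMonoidHom.zero_apply, AddMonoidHom.comp_apply, hx, map_zsmul, map_zsmul]
    change x • χ (Submodule.Quotient.mk (Pi.single j (1 : ℤ))) = 0
    rw [hzero j, smul_zero]
  obtain ⟨x, rfl⟩ := Submodule.Quotient.mk_surjective M q
  exact DFunLike.congr_fun hcomp x

variable {K V ι : Type*} [Field K] [AddCommGroup V] [Module K V] [FiniteDimensional K V]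

/-- A family of linear functionals separating the points of a finite-dimensional vector space spans
the dual space (double-annihilator: the joint kernel of the span is `0`). [folklore] -/
private theorem span_range_dual_eq_top (a : ι → Module.Dual K V) (hsep : ∀ v, (∀ i, a i v = 0) → v = 0) :
    Submodule.span K (Set.range a) = ⊤ := by
  have h0 : (Submodule.span K (Set.range a)).dualCoannihilator = ⊥ := by
    rw [eq_bot_iff]
    intro v hv
    rw [Submodule.mem_dualCoannihilator] at hv
    exact (Submodule.mem_bot K).mpr (hsep v fun i ↦ hv (a i) (Submodule.subset_span ⟨i, rfl⟩))
  rw [← Subspace.dualCoannihilator_dualAnnihilator_eq (W := Submodule.span K (Set.range a)), h0,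
    Submodule.dualAnnihilator_bot]

variable [CharZero K]

/-- **Integral bases.** Let `(aᵢ)` be linear functionals separating the points of the
finite-dimensional `K`-vector space `V` (`char K = 0`), `L` the subgroup of vectors on which every
`aᵢ` is an integer, and suppose `L` spans `V`. Then `V` has a `K`-basis `w` contained in `L` in which
the members of `L` have INTEGER coordinates (so `L = ⊕ ℤ wⱼ` is a full lattice): `L` embeds into
`ℤ^d` through finitely many of the `aᵢ` (a basis of `V^*` among them, `span_range_dual_eq_top`), hence
is free of rank `≤ d = dim V`, and it contains a `K`-basis, hence has rank `≥ d`. [folklore] -/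
private theorem exists_int_basis (a : ι → Module.Dual K V) (hsep : ∀ v, (∀ i, a i v = 0) → v = 0)
    (L : Submodule ℤ V) (hL : ∀ v, v ∈ L ↔ ∀ i, ∃ z : ℤ, (z : K) = a i v)
    (hspan : Submodule.span K (L : Set V) = ⊤) :
    ∃ (d : ℕ) (w : Module.Basis (Fin d) K V), (∀ j, w j ∈ L) ∧
      ∀ v ∈ L, ∀ j, ∃ n : ℤ, (n : K) = w.repr v j := by
  classical
  haveI : IsAddTorsionFree V := .of_isTorsionFree K V
  -- a basis `b` of the dual space among the `a i`
  obtain ⟨b, hb, hbspan, hbli⟩ := exists_linearIndependent K (Set.range a)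
  rw [span_range_dual_eq_top a hsep] at hbspan
  have hbfin : b.Finite := hbli.set_finite_of_isNoetherian
  haveI : Fintype b := hbfin.fintype
  -- the coordinate map `Ψ v = (φ v)_{φ ∈ b}` is injective
  let Ψ : V →ₗ[K] (b → K) := LinearMap.pi fun φ : b ↦ (φ : Module.Dual K V)
  have hΨ : ∀ v (φ : b), Ψ v φ = (φ : Module.Dual K V) v := fun v φ ↦ rfl
  have hΨinj : Function.Injective Ψ := by
    rw [← LinearMap.ker_eq_bot, LinearMap.ker_eq_bot']
    intro v hv
    refine hsep v fun i ↦ ?_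
    have hmem : a i ∈ Submodule.span K b := by rw [hbspan]; exact Submodule.mem_top
    have hall : ∀ φ ∈ Submodule.span K b, φ v = 0 := by
      intro φ hφ
      induction hφ using Submodule.span_induction with
      | mem φ hφb => simpa [hΨ] using congr_fun hv ⟨φ, hφb⟩
      | zero => simp
      | add φ ψ _ _ h₁ h₂ => simp [h₁, h₂]
      | smul c φ _ h₁ => simp [h₁]
    exact hall _ hmem
  -- the integer lattice `Λ₀ ⊂ K^b` and the restriction of `Ψ` to `L`
  let Λ₀ : Submodule ℤ (b → K) :=
    Submodule.span ℤ (Set.range fun φ : b ↦ (Pi.single φ (1 : K) : b → K))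
  have hΨL : ∀ v ∈ L, Ψ v ∈ Λ₀ := by
    intro v hv
    rw [← Finset.univ_sum_single (Ψ v)]
    refine Submodule.sum_mem _ fun φ _ ↦ ?_
    obtain ⟨i, hi⟩ := hb φ.2
    obtain ⟨z, hz⟩ := (hL v).mp hv i
    have : Ψ v φ = (z : K) := by rw [hΨ, ← hi] at *; exact hz.symm
    rw [this, show (Pi.single φ (z : K) : b → K) = z • Pi.single φ (1 : K) by
      ext ψ; simp [Pi.single_apply]]
    exact Submodule.smul_mem _ _ (Submodule.subset_span ⟨φ, rfl⟩)
  let ΨL : L →ₗ[ℤ] Λ₀ :=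
    { toFun := fun v ↦ ⟨Ψ v, hΨL v v.2⟩
      map_add' := fun v v' ↦ by ext; simp
      map_smul' := fun n v ↦ by ext; simp }
  have hΨLinj : Function.Injective ΨL := by
    intro v v' h
    apply Subtype.ext
    apply hΨinj
    simpa [ΨL] using congr_arg Subtype.val h
  haveI : Module.Finite ℤ Λ₀ := Module.Finite.span_of_finite ℤ (Set.finite_range _)
  haveI : Module.Finite ℤ L := Module.Finite.of_injective ΨL hΨLinj
  -- rank bound from above
  have hle : Module.finrank ℤ L ≤ Fintype.card b :=
    (LinearMap.finrank_le_finrank_of_injective hΨLinj).trans (finrank_range_le_card _)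
  have hcardb : Fintype.card b = Module.finrank K V := by
    have h1 := finrank_span_eq_card hbli
    rw [Subtype.range_coe, hbspan, finrank_top, Subspace.dual_finrank_eq] at h1
    exact h1.symm
  -- rank bound from below: a `K`-basis of `V` inside `L`
  obtain ⟨s, hsL, hsspan, hsli⟩ := exists_linearIndependent K (L : Set V)
  rw [hspan] at hsspan
  have hsfin : s.Finite := hsli.set_finite_of_isNoetherian
  haveI : Fintype s := hsfin.fintype
  have hcards : Fintype.card s = Module.finrank K V := by
    have h1 := finrank_span_eq_card hsli
    rw [Subtype.range_coe, hsspan, finrank_top] at h1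
    exact h1.symm
  have hsliZ : LinearIndependent ℤ (fun x : s ↦ (⟨(x : V), hsL x.2⟩ : L)) := by
    have h1 : LinearIndependent ℤ ((↑) : s → V) :=
      hsli.restrict_scalars (R := ℤ) fun r r' h ↦ Int.cast_injective (α := K)
        (by simpa only [Int.smul_one_eq_cast] using h)
    exact LinearIndependent.of_comp L.subtype h1
  have hge : Module.finrank K V ≤ Module.finrank ℤ L := by
    rw [← hcards]; exact hsliZ.fintype_card_le_finrank
  have hrank : Module.finrank ℤ L = Module.finrank K V := le_antisymm (hcardb ▸ hle) hge
  -- a `ℤ`-basis `h` of `L`; its vectors form a `K`-basis `w` of `V`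
  set d := Module.finrank K V with hd
  let h : Module.Basis (Fin d) ℤ L := Module.finBasisOfFinrankEq ℤ L hrank
  let w : Fin d → V := fun j ↦ (h j : V)
  have hexp : ∀ v (hv : v ∈ L), ∑ j, ((h.repr ⟨v, hv⟩ j : ℤ) : K) • w j = v := by
    intro v hv
    have h1 : (∑ j, ((h.repr ⟨v, hv⟩ j • h j : L) : V)) = v := by
      simpa only [Submodule.coe_sum] using congr_arg Subtype.val (h.sum_repr ⟨v, hv⟩)
    conv_rhs => rw [← h1]
    refine Finset.sum_congr rfl fun j _ ↦ ?_
    rw [Submodule.coe_smul_of_tower, Int.cast_smul_eq_zsmul]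
  have hspanw : ⊤ ≤ Submodule.span K (Set.range w) := by
    rw [← hspan, Submodule.span_le]
    intro v hv
    rw [SetLike.mem_coe, ← hexp v hv]
    exact Submodule.sum_mem _ fun j _ ↦
      Submodule.smul_mem _ _ (Submodule.subset_span ⟨j, rfl⟩)
  have hwli : LinearIndependent K w :=
    linearIndependent_of_top_le_span_of_card_eq_finrank hspanw (by rw [Fintype.card_fin])
  refine ⟨d, Module.Basis.mk hwli hspanw, fun j ↦ by rw [Module.Basis.mk_apply]; exact (h j).2,
    fun v hv j ↦ ⟨h.repr ⟨v, hv⟩ j, ?_⟩⟩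
  have h1 : (Module.Basis.mk hwli hspanw).equivFun.symm
      (fun j ↦ ((h.repr ⟨v, hv⟩ j : ℤ) : K)) = v := by
    rw [Module.Basis.equivFun_symm_apply]
    simp only [Module.Basis.mk_apply]
    exact hexp v hv
  have h2 := congr_arg (Module.Basis.mk hwli hspanw).equivFun h1
  rw [LinearEquiv.apply_symm_apply] at h2
  have h3 := congr_fun h2 j
  rw [Module.Basis.equivFun_apply] at h3
  exact h3

/-- **The abstract base-change / saturation theorem.** Let `(aᵢ)` be linear functionals separating
the points of the finite-dimensional `K`-vector space `V` (`char K = 0`), `L` the subgroup of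
vectors on which every `aᵢ` is an integer, and suppose `L` spans `V` over `K`. Then for every
subring `A ⊆ K`, a vector on which every `aᵢ` takes values in `A` is an `A`-linear combination of
members of `L`. (Via `exists_int_basis` and the saturation `span_int_eq_top_of_forall_rat_pairing`:
the coordinate functionals of an integral basis are integer combinations of the `aᵢ`.) [folklore] -/
private theorem mem_span_of_forall_dual_mem (a : ι → Module.Dual K V)
    (hsep : ∀ v, (∀ i, a i v = 0) → v = 0)
    (L : Submodule ℤ V) (hL : ∀ v, v ∈ L ↔ ∀ i, ∃ z : ℤ, (z : K) = a i v)
    (hspan : Submodule.span K (L : Set V) = ⊤) (A : Subring K) {v : V} (hv : ∀ i, a i v ∈ A) :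
    v ∈ Submodule.span A (L : Set V) := by
  classical
  obtain ⟨d, w, hwL, hwrepr⟩ := exists_int_basis a hsep L hL hspan
  -- the integer matrix `α i j` with `(α i j : K) = a i (w j)`
  have hαex : ∀ i j, ∃ z : ℤ, (z : K) = a i (w j) := fun i j ↦ (hL _).mp (hwL j) i
  choose α hα using hαex
  have hexpand : ∀ (x : Fin d → K) (i : ι), a i (w.equivFun.symm x) = ∑ j, x j * (α i j : K) := by
    intro x i
    rw [Module.Basis.equivFun_symm_apply, map_sum]
    refine Finset.sum_congr rfl fun j _ ↦ ?_
    rw [map_smul, smul_eq_mul, hα]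
  -- the rows `α i` span `ℤ^d` (saturation)
  have hM : Submodule.span ℤ (Set.range α) = ⊤ := by
    refine span_int_eq_top_of_forall_rat_pairing fun y hy j ↦ ?_
    set x : Fin d → K := fun j ↦ ((y j : ℚ) : K) with hx
    have hvy : w.equivFun.symm x ∈ L := by
      rw [hL]
      intro i
      obtain ⟨z, hz⟩ := hy (α i) ⟨i, rfl⟩
      refine ⟨z, ?_⟩
      rw [hexpand]
      have h1 := congr_arg (fun q : ℚ ↦ (q : K)) hz
      simp only [Rat.cast_intCast, Rat.cast_sum, Rat.cast_mul] at h1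
      rw [h1]
      exact Finset.sum_congr rfl fun j _ ↦ mul_comm _ _
    obtain ⟨n, hn⟩ := hwrepr _ hvy j
    have hrepr : w.repr (w.equivFun.symm x) j = x j := by
      rw [← Module.Basis.equivFun_apply, LinearEquiv.apply_symm_apply]
    rw [hrepr] at hn
    refine ⟨n, Rat.cast_injective (α := K) ?_⟩
    rw [Rat.cast_intCast]
    exact hn
  -- the coordinates of `v` in the basis `w` lie in `A`
  set x := w.equivFun v with hxdef
  have hvx : w.equivFun.symm x = v := by rw [hxdef, LinearEquiv.symm_apply_apply]
  have hav : ∀ i, a i v = ∑ l, x l * (α i l : K) := by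
    intro i
    have h1 := hexpand x i
    rwa [hvx] at h1
  have hxA : ∀ j, x j ∈ A := by
    intro j
    have hej : (Pi.single j (1 : ℤ) : Fin d → ℤ) ∈ Submodule.span ℤ (Set.range α) := by
      rw [hM]; exact Submodule.mem_top
    obtain ⟨c, hc⟩ := (Finsupp.mem_span_range_iff_exists_finsupp).mp hej
    have hcl : ∀ l, (∑ i ∈ c.support, c i * α i l) = (Pi.single j (1 : ℤ) : Fin d → ℤ) l := by
      intro l
      have h1 := congr_fun hc l
      simpa [Finsupp.sum, Finset.sum_apply] using h1
    have hxj : (∑ i ∈ c.support, (c i : K) * a i v) = x j := by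
      calc (∑ i ∈ c.support, (c i : K) * a i v)
          = ∑ i ∈ c.support, ∑ l, x l * ((c i : K) * (α i l : K)) := by
            refine Finset.sum_congr rfl fun i _ ↦ ?_
            rw [hav, Finset.mul_sum]
            exact Finset.sum_congr rfl fun l _ ↦ by ring
        _ = ∑ l, x l * ∑ i ∈ c.support, ((c i : K) * (α i l : K)) := by
            rw [Finset.sum_comm]
            exact Finset.sum_congr rfl fun l _ ↦ (Finset.mul_sum _ _ _).symm
        _ = ∑ l, x l * (((Pi.single j (1 : ℤ) : Fin d → ℤ) l : ℤ) : K) := by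
            refine Finset.sum_congr rfl fun l _ ↦ ?_
            rw [← hcl l]
            push_cast
            rfl
        _ = x j := by
            simp [Pi.single_apply]
    rw [← hxj]
    exact A.sum_mem fun i _ ↦ A.mul_mem (intCast_mem A (c i)) (hv i)
  -- conclusion: `v = ∑ xⱼ • wⱼ` with `xⱼ ∈ A`, `wⱼ ∈ L`
  rw [← hvx, Module.Basis.equivFun_symm_apply]
  refine Submodule.sum_mem _ fun j _ ↦ ?_
  have h1 : (⟨x j, hxA j⟩ : A) • w j ∈ Submodule.span A (L : Set V) :=
    Submodule.smul_mem _ _ (Submodule.subset_span (hwL j))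
  exact h1

end Lattice

/-! ### Cusp forms: `S_k(Γ₀(N); A)` is the `A`-span of `S_k(Γ₀(N); ℤ)` -/

section CuspForms

variable {N : ℕ} [NeZero N] {k : ℤ}

/-- **Agashe–Ribet–Stein 2006, Lemma 3.2 at `Γ = Γ₀(N)` ("`S₂(R) ≅ S₂(ℤ) ⊗ R`"), in every weight
`k ≥ 2`, proved**: for `N ≥ 1`, a subring `A ⊆ ℂ` and a cusp form `f ∈ S_k(Γ₀(N))` all of whose
Fourier coefficients `aₙ(f) = cuspCoeff f n` at `∞` lie in `A`, `f` is an `A`-linear combination of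
cusp forms with integer Fourier coefficients: `f ∈ span_A S_k(Γ₀(N); ℤ)`
(`S_k(Γ₀(N); ℤ) = integralCuspForms0 N k`). Equivalently the natural map
`S_k(Γ₀(N); ℤ) ⊗_ℤ A → S_k(Γ₀(N))` has image the forms with coefficients in `A` (the reverse
inclusion being trivial). Proof: the abstract saturation theorem `mem_span_of_forall_dual_mem` for
the coefficient functionals (separating: `q`-expansion principle, `eq_of_forall_cuspCoeff_eq_gamma0`)
and Shimura's integral basis (`span_setOf_int_cuspCoeff_eq_top`); the printed proof goes through
[DI95, Thm. 12.3.2, 12.3.7] instead. [cite: AgasheRibetStein2006, Lemma 3.2] -/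
theorem mem_span_integralCuspForms0_of_forall_cuspCoeff_mem (hk : 2 ≤ k) (A : Subring ℂ)
    {f : CuspForm (Gamma0 N) k} (hf : ∀ n, cuspCoeff f n ∈ A) :
    f ∈ Submodule.span A (integralCuspForms0 N k : Set (CuspForm (Gamma0 N) k)) := by
  haveI : FiniteDimensional ℂ (CuspForm (Gamma0 N) k) := finiteDimensional_cuspForm_gamma0 N k
  have hsep : ∀ g : CuspForm (Gamma0 N) k,
      (∀ n, cuspCoeffₗ (one_mem_strictPeriods_coe_gamma0 N) n g = 0) → g = 0 := by
    intro g hg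
    refine eq_of_forall_cuspCoeff_eq_gamma0 fun n ↦ ?_
    rw [← cuspCoeffₗ_apply (one_mem_strictPeriods_coe_gamma0 N) n g, hg n, cuspCoeff,
      CuspForm.coe_zero, qExpansion_zero, map_zero]
  have hL : ∀ g : CuspForm (Gamma0 N) k, g ∈ integralCuspForms0 N k ↔
      ∀ n, ∃ z : ℤ, (z : ℂ) = cuspCoeffₗ (one_mem_strictPeriods_coe_gamma0 N) n g :=
    fun g ↦ mem_integralCuspForms0
  have hspan : Submodule.span ℂ (integralCuspForms0 N k : Set (CuspForm (Gamma0 N) k)) = ⊤ := by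
    have hset : (integralCuspForms0 N k : Set (CuspForm (Gamma0 N) k)) =
        {g : CuspForm (Gamma0 N) k | ∀ m, ∃ z : ℤ, cuspCoeff g m = z} := by
      ext g
      simp only [SetLike.mem_coe, mem_integralCuspForms0, Set.mem_setOf_eq]
      exact forall_congr' fun m ↦ exists_congr fun z ↦ eq_comm
    rw [hset]
    exact span_setOf_int_cuspCoeff_eq_top N k hk
  exact mem_span_of_forall_dual_mem (fun n ↦ cuspCoeffₗ (one_mem_strictPeriods_coe_gamma0 N) n)
    hsep (integralCuspForms0 N k) hL hspan A hf

/-- The set form: for `k ≥ 2` and a subring `A ⊆ ℂ`, the cusp forms on `Γ₀(N)` with all Fourier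
coefficients in `A` are EXACTLY the `A`-span of `S_k(Γ₀(N); ℤ)` (ARS Lemma 3.2 at `Γ₀(N)`; the
inclusion `⊇` is closure of "coefficients in `A`" under `A`-linear combinations).
[cite: AgasheRibetStein2006, Lemma 3.2] -/
theorem setOf_forall_cuspCoeff_mem_eq_span_integralCuspForms0 (hk : 2 ≤ k) (A : Subring ℂ) :
    {f : CuspForm (Gamma0 N) k | ∀ n, cuspCoeff f n ∈ A} =
      (Submodule.span A (integralCuspForms0 N k : Set (CuspForm (Gamma0 N) k)) :
        Set (CuspForm (Gamma0 N) k)) := by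
  ext f
  refine ⟨fun hf ↦ mem_span_integralCuspForms0_of_forall_cuspCoeff_mem hk A hf, fun hf ↦ ?_⟩
  induction hf using Submodule.span_induction with
  | mem g hg =>
      intro n
      obtain ⟨z, hz⟩ := (mem_integralCuspForms0.mp hg) n
      rw [← hz]
      exact intCast_mem A z
  | zero =>
      intro n
      rw [cuspCoeff, CuspForm.coe_zero, qExpansion_zero, map_zero]
      exact A.zero_mem
  | add g g' _ _ hg hg' =>
      intro n
      rw [cuspCoeff_add_form (one_mem_strictPeriods_coe_gamma0 N) g g' n]
      exact A.add_mem (hg n) (hg' n)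
  | smul c g _ hg =>
      intro n
      change cuspCoeff ((c : ℂ) • g) n ∈ A
      rw [← cuspCoeffₗ_apply (one_mem_strictPeriods_coe_gamma0 N) n, map_smul, smul_eq_mul,
        cuspCoeffₗ_apply]
      exact A.mul_mem c.2 (hg n)

/-- **`S_k(Γ₀(N); A) = span_A S_k(Γ₀(N); ℤ)`** for `k ≥ 2` and every subring `A ⊆ ℂ` — ARS
Lemma 3.2 at `Γ₀(N)` for the `A`-submodule `integralCuspFormsIn N k A` of `IntegralCuspForms.lean`
(the inclusion `≥` is that file's `span_integralCuspForms0_le_integralCuspFormsIn`, the inclusion `≤`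
is `mem_span_integralCuspForms0_of_forall_cuspCoeff_mem`). [cite: AgasheRibetStein2006, Lemma 3.2] -/
theorem integralCuspFormsIn_eq_span_integralCuspForms0 (hk : 2 ≤ k) (A : Subring ℂ) :
    integralCuspFormsIn N k A =
      Submodule.span A (integralCuspForms0 N k : Set (CuspForm (Gamma0 N) k)) :=
  le_antisymm (fun _ hf ↦ mem_span_integralCuspForms0_of_forall_cuspCoeff_mem hk A hf)
    span_integralCuspForms0_le_integralCuspFormsIn

end CuspForms

end Literature.NumberTheory.EllipticCurves.ModularForms

end
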